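import Literature.Claims.NS.Taghizadeh2026
import Literature.Claims.NS.Godoi2016
import Literature.Barriers.NavierStokesRegularity.SmallDataGlobalRegularity
import Literature.Analysis.FluidPDE.ClayClassLerayHopfUniqueness
import Literature.Analysis.FluidPDE.SereginSverakPressureProofs
import Literature.Analysis.FluidPDE.ClassicalSuitable
import HarnessLib

/-!
# C166 `Taghizadeh2026` kit, part 2W (witness): a member of the print's solution class that does not vanish

D-0090 NS-CLAIMS SWEEP, claim C166 (E. Taghizadeh, *Exclusion of Singularities in the Three-Dimensional
Navier–Stokes Equations*, Zenodo 18468522 v2; skeleton `Literature/Claims/NS/Taghizadeh2026.lean`, rev 2),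
refuter kit (ns-claims-refuter-1 g5), filed through a salvage seat (conv. (b)).
(1) Every smooth bounded-energy solution of the unforced system on `ℝ³ × [0,∞)` (Fefferman's class (A):
`IsNavierStokesSolution` + `IsSmoothOnHalfSpace` + `HasBoundedEnergy`) is a member of the print's class
`IsSolution ν T` (§2.1 p.4 l.1–12) on every slab `(0,T) × ℝ³`, with the classical gradient as the weak gradient:
CKN suitability of classical solutions (tree `isSuitableWeakSolutionOn_of_classical`), the classical slice
derivative as weak spatial gradient (`hasWeakSpatialGradientOn_of_contDiffOn`), `u ∈ L^∞_t L²_x` from bounded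
energy, and `∇u ∈ L²((0,T) × ℝ³)` from the energy equality of finite-energy classical solutions (Tao 2013,
Lemma 8.1 = tree `energyClass_of_finiteEnergy`) plus Tonelli.
(2) A PRINT-CLASS WITNESS: the Kato small-data solution off `c₀ · u₀^{Godoi}` (explicit divergence-free Schwartz
datum, tree `Godoi2016.datum1`; `exists_clayA_smul`) has an interior point `z0 = (t0, x*)`, `t0 > 0`, and
`δ, m > 0`, `K ≥ 0` with `|u| ≥ m` and `‖D_x u‖ ≤ K` on the `δ`-ball about `z0` (continuity at `(0, x*)`, where
the datum is `c₀ e^{−2}(0,0,−2) ≠ 0`). Used by part 2E (`SoloRefuteTaghizadeh2026Step29E`).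
Tree convention `z = (t, x) : ℝ × EuclideanSpace ℝ (Fin 3)`.
WHAT THIS IS NOT: not a claim about NS regularity or blow-up; not a claim about any author beyond the typed
locator. [cite: Taghizadeh2026, §2.1 p.4 l.1–12]
-/

noncomputable section

set_option linter.dupNamespace false

namespace Summit.NavierStokesRegularity.NavierStokesRegularity.Theorems.Taghizadeh2026

namespace KillE

open MeasureTheory Set Metric Real Filter Function
open scoped ENNReal NNReal RealInnerProductSpace Topology ContDiff
open Literature.Analysis.FluidPDE Literature.Barriers.NavierStokesRegularity
open Literature.Claims.NS Literature.Claims.NS.Taghizadeh2026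

/-! ### The print's class contains every smooth bounded-energy (Clay (A)) solution -/

/-- **Clay-class solutions are members of the print's solution class on every slab**: CKN suitability of
classical solutions, the classical gradient as weak gradient, `u ∈ L^∞_t L²_x` from bounded energy, and
`∇u ∈ L²((0,T) × ℝ³)` from the energy equality of finite-energy classical solutions (Tao 2013, Lemma 8.1). -/
theorem isSolution_of_clay {ν T : ℝ} (hν : 0 < ν) (hT : 0 < T) {u₀ : E3 → E3} {u : ℝ → E3 → E3}
    {p : ℝ → E3 → ℝ} (hns : IsNavierStokesSolution ν 0 u₀ u p) (hu : IsSmoothOnHalfSpace u)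
    (hp : IsSmoothOnHalfSpace p) (hE : HasBoundedEnergy u) :
    IsSolution ν T u p (fun t x => fderiv ℝ (u t) x) := by
  have hcl : IsClassicalNSSolutionOn (Icc 0 T) ν 0 u p := hns.isClassicalNSSolutionOn_Icc hu hp hT
  have hclo : IsClassicalNSSolutionOn (Ico 0 T) ν 0 u p :=
    hcl.mono Ico_subset_Icc_self (uniqueDiffOn_Ico 0 T)
  have hfe : ∃ A : ℝ≥0∞, A < ⊤ ∧ ∀ t ∈ Icc 0 T, ∫⁻ x, ‖u t x‖ₑ ^ 2 ≤ A := by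
    obtain ⟨C, hC, hb⟩ := hE
    exact ⟨C, hC, fun t ht => hb t ht.1⟩
  obtain ⟨-, -, -, -, hdiss⟩ := energyClass_of_finiteEnergy hcl hν hT hfe
  have hu1 : ContDiffOn ℝ 1 (uncurry u) (Ioi (0 : ℝ) ×ˢ univ) :=
    (hu.of_le (by exact_mod_cast le_top)).mono (prod_mono Ioi_subset_Ici_self subset_rfl)
  have hslab : ((slab T : TopologicalSpace.Opens (ℝ × E3)) : Set (ℝ × E3)) ⊆ Ioi 0 ×ˢ univ :=
    fun z hz => ⟨hz.1.1, mem_univ _⟩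
  refine ⟨SereginSverak2002.isSuitableWeakSolutionOn_of_classical hclo (slab T) (fun z hz => hz),
    hasWeakSpatialGradientOn_of_contDiffOn isOpen_Ioi hslab hu1, ?_, ?_⟩
  · obtain ⟨C, hC, hb⟩ := hE
    refine ⟨C.toNNReal, (ae_restrict_iff' measurableSet_Ioo).2 (Eventually.of_forall fun t ht => ?_)⟩
    rw [ENNReal.coe_toNNReal hC.ne]
    exact hb t ht.1.le
  · -- Tonelli: the space–time integral over the slab is the iterated one
    set f : ℝ × E3 → ℝ≥0∞ := fun z => ENNReal.ofReal (frobeniusNormSq (fderiv ℝ (u z.1) z.2)) with hfdef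
    have hcont : ContinuousOn (fun z : ℝ × E3 => fderiv ℝ (u z.1) z.2) (Ioi 0 ×ˢ univ) :=
      continuousOn_fderiv_slice_of_contDiffOn hu1 isOpen_Ioi.uniqueDiffOn
    have hfc : ContinuousOn f (Ioo 0 T ×ˢ univ) :=
      (ENNReal.continuous_ofReal.comp LerayHopfProofs.continuous_frobeniusNormSq).comp_continuousOn
        (hcont.mono (prod_mono Ioo_subset_Ioi_self subset_rfl))
    have hμ : (volume : Measure (ℝ × E3)).restrict (Ioo 0 T ×ˢ univ) =
        ((volume : Measure ℝ).restrict (Ioo 0 T)).prod (volume : Measure E3) := by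
      conv_rhs => rw [← Measure.restrict_univ (μ := (volume : Measure E3))]
      rw [Measure.prod_restrict, ← Measure.volume_eq_prod]
    have hfm : AEMeasurable f (((volume : Measure ℝ).restrict (Ioo 0 T)).prod (volume : Measure E3)) := by
      rw [← hμ]
      exact hfc.aemeasurable (measurableSet_Ioo.prod MeasurableSet.univ)
    show ∫⁻ z in Ioo 0 T ×ˢ univ, f z < ⊤
    rw [hμ, lintegral_prod f hfm]
    exact hdiss

/-! ### A print-class witness that does not vanish at an interior point -/

/-- The test point `x* = (1,1,0)`, where the explicit Schwartz datum `u₀^{Godoi}(x*) = e^{−2}(0,0,−2) ≠ 0`. -/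
def xstar : E3 := !₂[1, 1, 0]

/-- The explicit datum does not vanish at `x*`. -/
lemma datum1_xstar_ne_zero : Godoi2016.datum1 xstar ≠ 0 := by
  intro h
  have h2 := congrArg (fun v : E3 => v 2) h
  simp [Godoi2016.datum1, xstar] at h2

/-- **Print-class witness.** For every `ν > 0` there is a smooth bounded-energy solution `(u, p)` of the unforced
Navier–Stokes system on `ℝ³ × [0, ∞)` with smooth divergence-free rapidly decaying datum (Fefferman (A) class;
Kato small data on `c₀ · u₀^{Godoi}`), an interior point `z0 = (t0, x*)` with `t0 > 0`, and `δ ∈ (0, t0]`,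
`m > 0`, `K ≥ 0` with `|u| ≥ m` and `‖D_x u‖ ≤ K` on the `δ`-ball about `z0`. -/
theorem exists_clay_solution_nonvanishing {ν : ℝ} (hν : 0 < ν) :
    ∃ (u₀ : E3 → E3) (u : ℝ → E3 → E3) (p : ℝ → E3 → ℝ),
      IsSmoothOnHalfSpace u ∧ IsSmoothOnHalfSpace p ∧ IsNavierStokesSolution ν 0 u₀ u p ∧ HasBoundedEnergy u ∧
      ∃ (z0 : ℝ × E3) (δ m K : ℝ), 0 < δ ∧ δ ≤ z0.1 ∧ 0 < m ∧ 0 ≤ K ∧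
        ∀ z : ℝ × E3, dist z z0 < δ →
          m ≤ ‖u z.1 z.2‖ ∧ DifferentiableAt ℝ (u z.1) z.2 ∧ ‖fderiv ℝ (u z.1) z.2‖ ≤ K := by
  have hsm : ∀ c : ℝ, HasRapidSpatialDecay (c • Godoi2016.datum1) := fun c n K => by
    obtain ⟨C, hC⟩ := Godoi2016.hasRapidSpatialDecay_datum1 n K
    refine ⟨|c| * C, fun x => ?_⟩
    have hn : ContDiffAt ℝ n Godoi2016.datum1 x :=
      (Godoi2016.contDiff_datum1.of_le (by exact_mod_cast le_top)).contDiffAt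
    rw [iteratedFDeriv_const_smul_apply hn, norm_smul, Real.norm_eq_abs]
    calc (1 + ‖x‖) ^ K * (|c| * ‖iteratedFDeriv ℝ n Godoi2016.datum1 x‖)
        = |c| * ((1 + ‖x‖) ^ K * ‖iteratedFDeriv ℝ n Godoi2016.datum1 x‖) := by ring
      _ ≤ |c| * C := mul_le_mul_of_nonneg_left (hC x) (abs_nonneg c)
  have hdf : ∀ c : ℝ, NSWave0.IsDivFree (c • Godoi2016.datum1) := fun c x => by
    have h := Godoi2016.isDivFree_datum1 x
    unfold NSWave0.divergence at h ⊢
    have hdiff : DifferentiableAt ℝ Godoi2016.datum1 x :=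
      (Godoi2016.contDiff_datum1.differentiable (by simp)).differentiableAt
    rw [fderiv_const_smul hdiff, ContinuousLinearMap.toLinearMap_smul, map_smul, h, smul_zero]
  -- Kato small data on a small multiple of the explicit Schwartz datum
  obtain ⟨c₀, hc₀, hsol⟩ := exists_clayA_smul hν Godoi2016.contDiff_datum1
    Godoi2016.isDivFree_datum1 Godoi2016.hasRapidSpatialDecay_datum1
  obtain ⟨u, p, hu, hp, hns, hE⟩ := hsol c₀ (by rw [abs_of_pos hc₀])
  refine ⟨c₀ • Godoi2016.datum1, u, p, hu, hp, hns, hE, ?_⟩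
  set U : ℝ × E3 → E3 := Function.uncurry u with hUdef
  have hUS : ContDiffOn ℝ ∞ U (Ici (0:ℝ) ×ˢ univ) := hu
  have hU0 : U (0, xstar) = c₀ • Godoi2016.datum1 xstar := by
    simp only [hUdef, Function.uncurry_apply_pair, hns.initial, Pi.smul_apply]
  have ha : 0 < ‖U (0, xstar)‖ := by
    rw [hU0, norm_smul, Real.norm_eq_abs, abs_of_pos hc₀]
    exact mul_pos hc₀ (norm_pos_iff.mpr datum1_xstar_ne_zero)
  set a : ℝ := ‖U (0, xstar)‖ with hadef
  -- continuity at `(0, x*)` within the half-space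
  have hcont : ContinuousWithinAt U (Ici (0:ℝ) ×ˢ univ) (0, xstar) :=
    hUS.continuousOn.continuousWithinAt ⟨le_refl (0:ℝ), mem_univ _⟩
  obtain ⟨δ₁, hδ₁, hδ₁U⟩ := (Metric.continuousWithinAt_iff.mp hcont) (a / 2) (by positivity)
  set t₀ : ℝ := δ₁ / 2 with ht₀
  have ht₀pos : 0 < t₀ := by positivity
  set z₀ : ℝ × E3 := (t₀, xstar) with hz₀
  -- gradient continuity on the open half-space `(0,∞) × ℝ³`
  set O : Set (ℝ × E3) := Ioi (0:ℝ) ×ˢ univ with hOdef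
  have hO : IsOpen O := isOpen_Ioi.prod isOpen_univ
  have hOS : O ⊆ Ici (0:ℝ) ×ˢ univ := prod_mono Ioi_subset_Ici_self subset_rfl
  have hUO : ContDiffOn ℝ ∞ U O := hUS.mono hOS
  have hz₀O : z₀ ∈ O := ⟨ht₀pos, mem_univ _⟩
  have hDcont : ContinuousOn (fderiv ℝ U) O :=
    hUO.continuousOn_fderiv_of_isOpen hO (by exact_mod_cast le_top)
  have hDat : ContinuousAt (fderiv ℝ U) z₀ := hDcont.continuousAt (hO.mem_nhds hz₀O)
  obtain ⟨δ₃, hδ₃, hδ₃U⟩ := (Metric.continuousAt_iff.mp hDat) 1 one_pos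
  set K : ℝ := ‖fderiv ℝ U z₀‖ + 1 with hKdef
  set δ : ℝ := min t₀ δ₃ with hδdef
  have hδpos : 0 < δ := lt_min ht₀pos hδ₃
  have hδt₀ : δ ≤ t₀ := min_le_left _ _
  have hδ3 : δ ≤ δ₃ := min_le_right _ _
  refine ⟨z₀, δ, a / 2, K, hδpos, hδt₀, by positivity, by positivity, fun z hz => ?_⟩
  have hzt : dist z.1 t₀ < δ := lt_of_le_of_lt (le_max_left _ _) (by rwa [Prod.dist_eq] at hz)
  have hzx : dist z.2 xstar < δ := lt_of_le_of_lt (le_max_right _ _) (by rwa [Prod.dist_eq] at hz)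
  have hz1pos : 0 < z.1 := by
    rw [Real.dist_eq] at hzt
    have := abs_lt.mp hzt
    linarith [this.1]
  have hzO : z ∈ O := ⟨hz1pos, mem_univ _⟩
  have hzS : z ∈ Ici (0:ℝ) ×ˢ univ := hOS hzO
  have hz0 : dist z ((0:ℝ), xstar) < δ₁ := by
    rw [Prod.dist_eq, max_lt_iff]
    constructor
    · simp only [Real.dist_eq, sub_zero]
      rw [Real.dist_eq] at hzt
      have := abs_lt.mp hzt
      rw [abs_lt]; constructor <;> linarith [this.1, this.2]
    · simp only
      linarith [hzx]
  have hnear : dist (U z) (U (0, xstar)) < a / 2 := hδ₁U hzS hz0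
  have hm : a / 2 ≤ ‖u z.1 z.2‖ := by
    show a / 2 ≤ ‖U z‖
    rw [dist_eq_norm] at hnear
    have := norm_sub_norm_le (U (0, xstar)) (U z)
    rw [← norm_neg, neg_sub] at hnear
    linarith [this, hnear]
  have hUdiff : DifferentiableAt ℝ U z :=
    (hUO.differentiableOn (by simp) z hzO).differentiableAt (hO.mem_nhds hzO)
  have hslice : HasFDerivAt (u z.1) ((fderiv ℝ U z).comp (ContinuousLinearMap.inr ℝ ℝ E3)) z.2 := by
    have h1 : HasFDerivAt (fun x : E3 => (z.1, x)) (ContinuousLinearMap.inr ℝ ℝ E3) z.2 :=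
      hasFDerivAt_prodMk_right z.1 z.2
    have h2 : HasFDerivAt U (fderiv ℝ U z) (z.1, z.2) := hUdiff.hasFDerivAt
    exact h2.comp z.2 h1
  refine ⟨hm, hslice.differentiableAt, ?_⟩
  rw [hslice.fderiv]
  have hKz : ‖fderiv ℝ U z‖ ≤ K := by
    have h := hδ₃U (lt_of_lt_of_le hz hδ3)
    rw [dist_eq_norm] at h
    have := norm_sub_norm_le (fderiv ℝ U z) (fderiv ℝ U z₀)
    rw [hKdef]; linarith
  calc ‖(fderiv ℝ U z).comp (ContinuousLinearMap.inr ℝ ℝ E3)‖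
      ≤ ‖fderiv ℝ U z‖ * ‖ContinuousLinearMap.inr ℝ ℝ E3‖ := ContinuousLinearMap.opNorm_comp_le _ _
    _ ≤ K * 1 := mul_le_mul hKz (ContinuousLinearMap.norm_inr_le_one ℝ ℝ E3) (norm_nonneg _)
        (by rw [hKdef]; positivity)
    _ = K := mul_one K

end KillE

end Summit.NavierStokesRegularity.NavierStokesRegularity.Theorems.Taghizadeh2026

end
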